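import Literature.MathematicalPhysics.QuantumFieldTheory.Balaban1983to89.B6Eq2106
import Literature.MathematicalPhysics.QuantumFieldTheory.Balaban1983to89.B6Eq297GaugeFixing

/-!
# `Balaban1983to89.B6Eq2112` — T. Bałaban, *Propagators and renormalization transformations for lattice gauge
# theories. II*, Commun. Math. Phys. **96** (1984) 223–250 [Balaban1984PropagatorsII], Sect. C pp. 240–243:
# *"Calculating these integrals we get (2.111). This implies further (2.112)"* — (2.111) as an identity of the
# ω-integrals, and the integrand bookkeeping (2.95) ⇒ (2.97) ⇒ (2.105) ⇒ (2.112), PROVED over the abstract carriers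
# of `…B6Eq295` / `…B6Eq2106`

statement-level skeleton of published theorems with citation tags; proofs where landed; nothing here is a claim about the Yang–Mills mass gap

PDF held: `paper:balaban1984-cmp96-propagators-rt-ii` (journal page = PDF page + 222); pp. 240–243 [PDF 18–21] read AS
IMAGES on the ×2 renders `run/shared/lean/pub/pub-balaban/b2b-balaban-ref1/pages/1984-cmp96-propagators-rt-II/` (2026-08-21).
CITATION HEADER (lean-in-tree rule).  WHAT IS REPRODUCED: lit-balaban SKELETON rows **B6.Eq2.111 / B6.Eq2.112** (the
display (2.112) was until now the HYPOTHESIS `h2112` of `…B6GaussianIdentity2119.eq2119` (row B6.Eq2.119) and of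
`…B6Repr2129.eq2129` (row B6.Eq2.129); of (2.111) only the exponent algebra `…B6Eq295.eq2111_exponent` existed).  PHASE-2
seat p22 (gen 7); owner r03, referee ref-4.  IMPORTS, restating nothing: `…B6Eq2106` (r03: (2.105) ⇒ (2.106)
`eq2105_quotient`, and through it `…B6Eq295`: (2.95) `eq295_gaugeFactor`, (2.115) `eq2115`, (2.111) `eq2111_exponent`) and
`…B6Eq297GaugeFixing` (this seat: (1.27) for `P_j`, `eq127_j`).  The sibling `…B6Eq2112Assembly` (this seat) integrates the
present pointwise chain in the finite-dimensional Haar model and discharges `h2112`.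

PRINT (pp. 240–243, verbatim; `C` = C^{(j)}_Λ).  (2.95) *"e^{½⟨J,GJ⟩} = Z⁻¹∫dA exp[−½⟨QA,aQA⟩ − ½⟨A,(Δ−∂P∂*)A⟩ + ⟨A,J⟩]
= Z⁻¹∫dA exp[−½⟨QA,aQA⟩ − ½⟨A,ΔA⟩ + ⟨A,J⟩](Z′⁻¹∫dλδ(Q′λ)e^{−½‖∂*A−Δλ‖²})⁻¹ · [∫dω↾_Λδ(Q′₁ω)Πδ_{Ax(y)}(Q_jA+∂₁ω)Z′_j⁻¹
∫dλ′δ(Q′_jλ′)e^{−½‖∂*A−Δλ′‖²}]/[the same], (2.95) where we have used the identity (1.27) valid for this operator P also.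
… from the definition of δ_{Ax} we have ∫dω′↾_Λδ(Q′₁ω′)Πδ_{Ax(y)}(Q_jA+∂₁ω′) = 1. (2.96) … Let us apply (2.96) and (1.27)
to the denominator. … We have e^{½⟨J,GJ⟩} = ∫dω↾_Λδ(Q′₁ω)Z⁻¹∫dA exp[−½aΣ_{b∈Λ^c}|(Q_jA)(b)|² − ½aL^{d−2}Σ_{c∈Λ′}|(Q_{j+1}A)(c)|²
− ½‖∂A‖² − ½‖(I−P_j)∂*A‖² + ⟨A,J⟩] Πδ_{Ax(y)}(Q_jA+∂₁ω)Z′_j⁻¹∫dλ′δ(Q′_jλ′)e^{−½‖∂*A−Δλ′‖²}(Z′⁻¹∫dλδ(Q′λ)e^{−½‖∂*A−Δλ‖²})⁻¹.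
(2.97) … Let us make a gauge transformation in the integral ∫dA… defined by the function λ₀ = H′_jω, A → A − ∂λ₀ = A − ∂H′_jω.
This transformation does not change the measure dA and in the first exponential only the term ⟨A,J⟩ is changed into
⟨A − ∂H′_jω, J⟩. According to (2.103) the δ-functions δ_{Ax(y)}(Q_jA+∂₁ω) are changed into δ_{Ax(y)}(Q_jA). In the first
integral ∫dλ′… we get the expression ∂*A^{λ₀} − Δλ′ = ∂*A − Δ(λ′+λ₀), and we make the transformation λ′ → λ′ − λ₀. … In the
last integral in (Z′⁻¹∫dλ…)⁻¹ we make the same transformations … Thus this integral is not changed by the transformation.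
Taking into account all these changes we get [(2.105)]. … [(2.106), (2.107) Δ′_j = H′_j*Δ²H′_j] … From the theorem on unit
lattice operators in [3] it follows that a covariance C^{(j)}_Λ of the last Gaussian integrals in (2.106) is a bounded
operator … Calculating these integrals we get
exp[−⟨H′_j*Δ∂*A, CH′_j*∂*J⟩ + ½⟨H′_j*∂*J, CH′_j*∂*J⟩] = exp[−⟨A,∂ΔH′_jCH′_j*∂*J⟩ + ½⟨J,∂H′_jCH′_j*∂*J⟩]. (2.111)
This implies further e^{½⟨J,GJ⟩} = e^{½⟨J,∂H′_jCH′_j*∂*J⟩}Z⁻¹Z′_j⁻¹Z′ · ∫dB exp[−½aΣ_{b∈Λ^c}|B(b)|² − ½aL^{d−2}Σ_{c∈Λ′}|(Q₁B)(c)|²]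
Π_{y∈Λ′}δ_{Ax(y)}(B) · ∫dAδ(Q_jA−B) exp[−½⟨A,(Δ−∂P_j∂*)A⟩ + ⟨A, J − ∂ΔH′_jCH′_j*∂*J⟩]. (2.112)"*

TYPING (the conventions of `…B6Eq295`/`…B6Eq2106`, every hypothesis displayed; all δ-function integrals are integrals
over a parameter space of the constraint set against a left-invariant measure; no integrability is assumed in this
file — both sides of each identity are junk together).  `A` = vector fields (`Δ` = `lapV`, `∂` on vector fields entering
only through `⟨A,ΔA⟩ = ‖∂A‖² + ‖∂*A‖²` (`curl`, `hlapV`)), `B` = scalar functions on the `ξ`-lattice (`Δ` = `lap`,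
`∂` = `grad : B → A`, `∂*` = `dv : A → B` its adjoint (`hgrad`), `∂*∂ = Δ` (`hΔ`), `∂∂ = 0` (`hcurl`)), `W` = unit-lattice
scalar functions (values of `Q′_j` = `Qp`; `H′_j` = `hP : W → B` with adjoint `hPs` (`hH`), `Q′_jH′_j = I` (`hQpH`,
`…B6Eq295.comp_hPrime_eq_id`)), `Bs` = unit-lattice vector fields (values of `Q_j` = `Qv`; `∂₁` = `d1 : W → Bs`,
(2.103) line 1 `Q_j∂ = ∂₁Q′_j` (`h2103`, row B6.Eq2.103)), `V` = the range of `Q″` (`Qpp : Bs → V`, weight `a`; the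
first two terms of the exponent of (2.97) are `½⟨QA,aQA⟩ = ½⟨Q″Q_jA, aQ″Q_jA⟩`, row B6.Eq2.119 `…B6GaussianIdentity2119.qpp`),
and (2.104) *"these terms are invariant iff ∂₁μ = 0 on Λ^c and ∂^LQ′₁μ = 0 on Λ′ … the unit lattice gauge functions ω
appearing in the integral (2.97) satisfy the above conditions"* is `h2104 : Q″∂₁ω = 0` for the admissible `ω` (parameter
space `N1`, `ε : N1 → W`).  `∫dλδ(Q′λ)(·)` = `∫ (·)(κ m) dμ'` (`κ : NQ → B`; `R` = the orthogonal projection onto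
`ΔN(Q′) = range (Δ∘κ)` = `K` (`hK`), `P = I − R` (`hPK`)); `∫dλ′δ(Q′_jλ′)(·)` = `∫ (·)(ι n) dμj` (`R_j` onto `ΔN(Q′_j) =
range (Δ∘ι)` = `Kj` (`hKj`, `hRj`), `P_j = I − R_j` (`hPj`)); `∫dλ′δ(Q′_jλ′ − ω)(·)` = `∫ (·)(ι n + H′_jω) dμj` (*"the
translation λ′ → λ′ + H′_jω"*, `…B6Eq2106` §2); `λ₀ = H′_jω ∈ N(Q′)` (`hκ`, *"Q′_jλ₀ = ω = 0 on Λ^c, Q′_{j+1}λ₀ = Q′₁ω = 0 on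
Λ′"*); `ΔH′_jω ⊥ ΔN(Q′_j)` (`horth`, = `…B6Eq2106.orth_of_hPrime` for the printed `H′_j` (2.101)); the remark *"∫dω′↾_Λ
δ(Q′₁ω′)δ(Q′_jλ′ − ω′) = δ(Q′λ′)"* is the displayed hypothesis `hX` (the `N(Q′)`-Gaussian equals a constant `cX` times the
iterated one — in the finite-dimensional model `cX` is a Haar scalar factor, `…B6Eq2106.iterated_eq_smul_addHaar`);
*"a covariance C^{(j)}_Λ of the last Gaussian integrals in (2.106)"* is typed as in `…B6Eq295.eq2115`: `C = ε∘T_C` ranges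
in the admissible `ω`'s and inverts `Δ′_j` there (`hCr`, `hCsol`), symmetric (`hC`), with normalisation `Z_C ≠ 0` (`hZC`).
`Πδ_{Ax(y)}(·)` does not appear in this file: the statements below are POINTWISE in the configuration (the product of the
`δ_{Ax}` rides along unchanged and is integrated in `…B6Eq2112Assembly`, where (2.96) = *"exactly one admissible ω per
configuration"* becomes a linear change of variables).

CONTENTS (theorems only; 0 defs; standard axioms).
§1 **`eq2111`** — *"Calculating these integrals we get (2.111)"*: the quotient of the two ω-integrals of the third member of
   (2.106) equals `exp[−⟨H′_j*Δ∂*A, CH′_j*∂*J⟩ + ½⟨H′_j*∂*J, CH′_j*∂*J⟩]` (two applications of `…B6Eq295.eq2115` on the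
   admissible `ω`'s + `eq2111_exponent`); **`eq2111_printed`** — the printed right-hand rewriting `= exp[−⟨A,∂ΔH′_jCH′_j*∂*J⟩
   + ½⟨J,∂H′_jCH′_j*∂*J⟩]` (adjointness), i.e. the operators `K₂ = ∂ΔH′_jCH′_j*∂*`, `K₁ = ∂H′_jCH′_j*∂*` of (2.112).
§2 the pointwise chain: `starProjection_lap_hP` (`R_jΔH′_jω = 0`), `integrand_295_eq_297` ((2.95)₁-integrand = (2.97)-integrand
   at fixed `A`: `…B6Eq295.eq295_gaugeFactor` + `…B6Eq297GaugeFixing.eq127_j`), `qterm_invariant` ((2.103)–(2.104)),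
   **`integrand_297_eq_2105`** (the gauge transformation `A → A − ∂H′_jω`: the (2.97) integrand at `A − ∂H′_jω` is the (2.105)
   integrand at `A`), **`integral_2105_omega`** (the ω-integral of the (2.105) integrand at fixed `A` =
   `Z′Z′_j⁻¹cX⁻¹ · e^{½⟨J,K₁J⟩} · exp[−½⟨QA,aQA⟩ − ½‖∂A‖² − ½‖(I−P_j)∂*A‖² + ⟨A, J − K₂J⟩]`, by `…B6Eq2106.eq2105_quotient` +
   `eq2111`), `integrand_2112` (the last exponential = `exp[−½⟨QA,aQA⟩ − ½⟨A,(Δ−∂P_j∂*)A⟩ + ⟨A,J − K₂J⟩]`, the integrand of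
   (2.112)), `Y_translate`/`X_translate` (the `λ′`- and `λ`-integrals under `A → A − ∂λ₀`), `Zlam_ne_zero` (by (2.25)).
HONEST SCOPE: abstract carriers, displayed hypotheses; the value is a kernel certificate of the printed bookkeeping (constants
`Z⁻¹Z′_j⁻¹Z′`, sources `J − K₂J`, factor `e^{½⟨J,K₁J⟩}`), NOT summit progress.  Unit `lit-balaban-p22` (gen 7), 2026-08-21.
-/

noncomputable section

open MeasureTheory
open scoped InnerProductSpace

namespace Literature.MathematicalPhysics.QuantumFieldTheory.Balaban1983to89.B6Eq2112

/-! ## §1  *"Calculating these integrals we get (2.111)"* -/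

section Eq2111

variable {W N1 : Type*} [NormedAddCommGroup W] [InnerProductSpace ℝ W]
  [AddCommGroup N1] [Module ℝ N1] [MeasurableSpace N1] [MeasurableAdd N1]

/-- **(2.111) as an identity of the ω-integrals.**  The third member of (2.106) is the quotient of two Gaussian integrals
over the admissible `ω`'s (`∫dω↾_Λδ(Q′₁ω)(·)` = `∫ (·)(ε ω) dν`, `ν` left-invariant) with the same quadratic form
`½⟨ω,Δ′_jω⟩` (`Dp` = Δ′_j, symmetric) and the sources `f − g` and `f` (`f = H′_j*Δ∂*A`, `g = H′_j*∂*J`).  If `C` (= C^{(j)}_Λ,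
*"a covariance of the last Gaussian integrals in (2.106)"*) ranges in the admissible `ω`'s and inverts `Δ′_j` there
(`hCr`, `hCsol`), is symmetric, and the normalisation `Z_C = ∫dω↾_Λδ(Q′₁ω)e^{−½⟨ω,Δ′_jω⟩}` is not zero, then
`[∫dω↾δ(Q′₁ω)e^{−½⟨ω,Δ′_jω⟩}e^{⟨ω,f−g⟩}] · [∫dω′↾δ(Q′₁ω′)e^{−½⟨ω′,Δ′_jω′⟩}e^{⟨ω′,f⟩}]⁻¹ = exp[−⟨f, Cg⟩ + ½⟨g, Cg⟩]` —
*"Calculating these integrals we get exp[−⟨H′_j*Δ∂*A, C^{(j)}_ΛH′_j*∂*J⟩ + ½⟨H′_j*∂*J, C^{(j)}_ΛH′_j*∂*J⟩]"*.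
[cite: Balaban1984PropagatorsII, (2.111) p.242] -/
theorem eq2111 (ν : Measure N1) [ν.IsAddLeftInvariant] (ε : N1 →ₗ[ℝ] W) (Dp C : W →ₗ[ℝ] W) (TC : W →ₗ[ℝ] N1)
    (hDp : ∀ x y : W, ⟪Dp x, y⟫_ℝ = ⟪x, Dp y⟫_ℝ) (hC : ∀ x y : W, ⟪C x, y⟫_ℝ = ⟪x, C y⟫_ℝ)
    (hCr : ∀ s, C s = ε (TC s)) (hCsol : ∀ (ω : N1) (s : W), ⟪ε ω, Dp (C s)⟫_ℝ = ⟪ε ω, s⟫_ℝ)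
    (hZC : ∫ ω, Real.exp (-(1 / 2) * ⟪ε ω, Dp (ε ω)⟫_ℝ) ∂ν ≠ 0) (f g : W) :
    (∫ ω, Real.exp (-(1 / 2) * ⟪ε ω, Dp (ε ω)⟫_ℝ) * Real.exp ⟪ε ω, f - g⟫_ℝ ∂ν) *
        (∫ ω, Real.exp (-(1 / 2) * ⟪ε ω, Dp (ε ω)⟫_ℝ) * Real.exp ⟪ε ω, f⟫_ℝ ∂ν)⁻¹ =
      Real.exp (-⟪f, C g⟫_ℝ + (1 / 2) * ⟪g, C g⟫_ℝ) := by
  have hmgf : ∀ s : W, ∫ ω, Real.exp (-(1 / 2) * ⟪ε ω, Dp (ε ω)⟫_ℝ) * Real.exp ⟪ε ω, s⟫_ℝ ∂ν =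
      Real.exp ((1 / 2) * ⟪s, C s⟫_ℝ) * ∫ ω, Real.exp (-(1 / 2) * ⟪ε ω, Dp (ε ω)⟫_ℝ) ∂ν := by
    intro s
    have h := B6Eq295.eq2115 ν ε Dp C TC hDp hCr hCsol s
    simp_rw [← Real.exp_add]
    exact h
  rw [hmgf (f - g), hmgf f, mul_inv, mul_mul_mul_comm, mul_inv_cancel₀ hZC, mul_one, ← Real.exp_neg,
    ← Real.exp_add, ← B6Eq295.eq2111_exponent C hC f g]
  ring_nf

variable {A B : Type*} [NormedAddCommGroup A] [InnerProductSpace ℝ A] [NormedAddCommGroup B] [InnerProductSpace ℝ B]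

omit [MeasurableSpace N1] [MeasurableAdd N1] in
/-- **(2.111), the printed right-hand rewriting.**  With `H′_j*` (`hPs`) the adjoint of `H′_j` (`hP`), `∂*` (`dv`) the
adjoint of `∂` (`grad`) and `Δ` (`lap`) symmetric:
`−⟨H′_j*Δ∂*A, CH′_j*∂*J⟩ + ½⟨H′_j*∂*J, CH′_j*∂*J⟩ = −⟨A, ∂ΔH′_jCH′_j*∂*J⟩ + ½⟨J, ∂H′_jCH′_j*∂*J⟩`, i.e. the operators
`K₂ = ∂ΔH′_jCH′_j*∂*` and `K₁ = ∂H′_jCH′_j*∂*` of (2.112). [cite: Balaban1984PropagatorsII, (2.111)–(2.112) pp.242–243] -/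
theorem eq2111_printed (lap : B →ₗ[ℝ] B) (hP : W →ₗ[ℝ] B) (hPs : B →ₗ[ℝ] W) (grad : B →ₗ[ℝ] A)
    (dv : A →ₗ[ℝ] B) (C : W →ₗ[ℝ] W) (hlap : ∀ x y : B, ⟪lap x, y⟫_ℝ = ⟪x, lap y⟫_ℝ)
    (hH : ∀ (w : W) (b : B), ⟪hP w, b⟫_ℝ = ⟪w, hPs b⟫_ℝ) (hgrad : ∀ (b : B) (J : A), ⟪grad b, J⟫_ℝ = ⟪b, dv J⟫_ℝ)
    (v J : A) :
    -⟪hPs (lap (dv v)), C (hPs (dv J))⟫_ℝ + (1 / 2) * ⟪hPs (dv J), C (hPs (dv J))⟫_ℝ =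
      -⟪v, (grad ∘ₗ lap ∘ₗ hP ∘ₗ C ∘ₗ hPs ∘ₗ dv) J⟫_ℝ + (1 / 2) * ⟪J, (grad ∘ₗ hP ∘ₗ C ∘ₗ hPs ∘ₗ dv) J⟫_ℝ := by
  have hHs : ∀ (b : B) (w : W), ⟪hPs b, w⟫_ℝ = ⟪b, hP w⟫_ℝ := fun b w => by
    rw [real_inner_comm, ← hH, real_inner_comm]
  have hdv : ∀ (x : A) (b : B), ⟪dv x, b⟫_ℝ = ⟪x, grad b⟫_ℝ := fun x b => by
    rw [real_inner_comm, ← hgrad, real_inner_comm]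
  simp only [LinearMap.coe_comp, Function.comp_apply]
  rw [hHs, hlap, hdv, hHs, hdv]

end Eq2111

/-! ## §2  The pointwise chain (2.95) ⇒ (2.97) ⇒ (2.105) ⇒ (2.112) at a fixed configuration -/

section Pointwise

variable {A B W T Bs V Nj NQ N1 : Type*}
  [NormedAddCommGroup A] [InnerProductSpace ℝ A] [NormedAddCommGroup B] [InnerProductSpace ℝ B]
  [NormedAddCommGroup W] [InnerProductSpace ℝ W] [NormedAddCommGroup T] [InnerProductSpace ℝ T]
  [AddCommGroup Bs] [Module ℝ Bs] [NormedAddCommGroup V] [InnerProductSpace ℝ V]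
  [AddCommGroup Nj] [Module ℝ Nj] [MeasurableSpace Nj]
  [AddCommGroup NQ] [Module ℝ NQ] [MeasurableSpace NQ]
  [AddCommGroup N1] [Module ℝ N1] [MeasurableSpace N1]

omit [MeasurableSpace Nj] in
/-- `R_jΔH′_jω = 0`: the `Δ`-image of `H′_jω` is orthogonal to `ΔN(Q′_j) = range (Δ∘ι)` (`horth`; for the printed `H′_j`
of (2.101) this is `…B6Eq2106.orth_of_hPrime`), hence killed by the orthogonal projection `R_j` — the mechanism of (2.98):
*"‖(I−P_j)∂*A^λ‖² = ‖(I−P_j)(∂*A − Δλ)‖² = ‖(I−P_j)∂*A‖²"* for `λ = H′_jμ`. [cite: Balaban1984PropagatorsII, (2.98)–(2.101) pp.240–241] -/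
theorem starProjection_lap_hP (lap : B →ₗ[ℝ] B) (hP : W →ₗ[ℝ] B) (ι : Nj →ₗ[ℝ] B) (Kj : Submodule ℝ B)
    [Kj.HasOrthogonalProjection] (hKj : LinearMap.range (lap ∘ₗ ι) = Kj)
    (horth : ∀ (n : Nj) (w : W), ⟪lap (ι n), lap (hP w)⟫_ℝ = 0) (w : W) :
    Kj.starProjection (lap (hP w)) = 0 := by
  rw [Submodule.starProjection_apply_eq_zero_iff, Submodule.mem_orthogonal]
  intro u hu
  obtain ⟨n, rfl⟩ := LinearMap.mem_range.mp (hKj ▸ hu : u ∈ LinearMap.range (lap ∘ₗ ι))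
  exact horth n w

omit [MeasurableSpace Nj] [MeasurableSpace N1] in
/-- **(2.103)–(2.104): the first two terms of the quadratic form are invariant.**  With (2.103) line 1 `Q_j∂λ = ∂₁Q′_jλ`
(`h2103`), `Q′_jH′_j = I` (`hQpH`) and (2.104) for the admissible `ω` (`h2104 : Q″∂₁ω = 0`):
`Q″Q_j(A − ∂H′_jω) = Q″Q_jA` — *"Hence these terms are invariant … This matches our needs exactly because the unit lattice
gauge functions ω appearing in the integral (2.97) satisfy the above conditions"*. [cite: Balaban1984PropagatorsII, (2.103)–(2.104) p.241] -/
theorem qterm_invariant (grad : B →ₗ[ℝ] A) (hP : W →ₗ[ℝ] B) (ε : N1 →ₗ[ℝ] W) (Qp : B →ₗ[ℝ] W)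
    (hQpH : Qp ∘ₗ hP = LinearMap.id) (Qv : A →ₗ[ℝ] Bs) (d1 : W →ₗ[ℝ] Bs) (Qpp : Bs →ₗ[ℝ] V)
    (h2103 : ∀ b : B, Qv (grad b) = d1 (Qp b)) (h2104 : ∀ ω : N1, Qpp (d1 (ε ω)) = 0) (v : A) (ω : N1) :
    Qpp (Qv (v - grad (hP (ε ω)))) = Qpp (Qv v) := by
  have h1 : Qp (hP (ε ω)) = ε ω := by simpa using LinearMap.congr_fun hQpH (ε ω)
  rw [map_sub, map_sub, h2103, h1, h2104, sub_zero]

omit [MeasurableSpace N1] in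
/-- *"In the first integral ∫dλ′… we get the expression ∂*A^{λ₀} − Δλ′ = ∂*A − Δ(λ′+λ₀), and we make the transformation
λ′ → λ′ − λ₀. After the transformation we obtain the same integral with the δ-functions δ(Q′_jλ′) replaced by …
δ(Q′_jλ′ − ω)"*: pointwise in `λ′`, `∂*(A − ∂H′_jω) − Δλ′ = ∂*A − Δ(λ′ + H′_jω)` (`∂*∂ = Δ`), so the `λ′`-integrand of (2.97)
at `A − ∂H′_jω` is the fibre integrand `δ(Q′_jλ′ − ω)` of (2.105) at `A` (fibre parametrised through `H′_j`, `…B6Eq2106` §2).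
[cite: Balaban1984PropagatorsII, (2.97) p.240, (2.105) p.242] -/
theorem Y_translate (μj : Measure Nj) (lap : B →ₗ[ℝ] B) (ι : Nj →ₗ[ℝ] B) (grad : B →ₗ[ℝ] A) (dv : A →ₗ[ℝ] B)
    (hΔ : ∀ b : B, dv (grad b) = lap b) (hP : W →ₗ[ℝ] B) (ε : N1 →ₗ[ℝ] W) (v : A) (ω : N1) :
    ∫ n, Real.exp (-(1 / 2) * ‖dv (v - grad (hP (ε ω))) - lap (ι n)‖ ^ 2) ∂μj =
      ∫ n, Real.exp (-(1 / 2) * ‖dv v - lap (ι n + hP (ε ω))‖ ^ 2) ∂μj := by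
  congr 1; funext n; rw [map_sub, hΔ, map_add]; congr 3; abel

omit [MeasurableSpace Nj] [MeasurableSpace N1] in
/-- *"In the last integral in (Z′⁻¹∫dλ…)⁻¹ we make the same transformations, only now in δ-functions we get Q′λ − Q′λ₀, and
Q′_jλ₀ = Q′_jH′_jω = ω = 0 on Λ^c, and Q′_{j+1}λ₀ = Q′₁ω = 0 on Λ′. Thus this integral is not changed by the transformation"*:
`λ₀ = H′_jω ∈ N(Q′)` (`hl₀`) and `dλ δ(Q′λ)` is translation invariant, so `X(A − ∂λ₀) = X(A)` for
`X(A) = ∫dλδ(Q′λ)e^{−½‖∂*A−Δλ‖²}`. [cite: Balaban1984PropagatorsII, (2.105) pp.241–242] -/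
theorem X_translate [MeasurableAdd NQ] (μ' : Measure NQ) [μ'.IsAddLeftInvariant] (lap : B →ₗ[ℝ] B)
    (κ : NQ →ₗ[ℝ] B) (grad : B →ₗ[ℝ] A) (dv : A →ₗ[ℝ] B) (hΔ : ∀ b : B, dv (grad b) = lap b) (l₀ : B)
    (hl₀ : ∃ m₀ : NQ, κ m₀ = l₀) (v : A) :
    ∫ m, Real.exp (-(1 / 2) * ‖dv (v - grad l₀) - lap (κ m)‖ ^ 2) ∂μ' =
      ∫ m, Real.exp (-(1 / 2) * ‖dv v - lap (κ m)‖ ^ 2) ∂μ' := by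
  obtain ⟨m₀, hm₀⟩ := hl₀
  have hfun : (fun m => Real.exp (-(1 / 2) * ‖dv (v - grad l₀) - lap (κ m)‖ ^ 2)) =
      fun m => (fun m' => Real.exp (-(1 / 2) * ‖dv v - lap (κ m')‖ ^ 2)) (m₀ + m) := by
    funext m; simp only [map_sub, hΔ, map_add, hm₀]; congr 3; abel
  rw [hfun]
  exact integral_add_left_eq_self (fun m' => Real.exp (-(1 / 2) * ‖dv v - lap (κ m')‖ ^ 2)) m₀

omit [MeasurableSpace N1] in
/-- **(2.95), first line ⇒ (2.97): the integrands agree at every configuration.**  With `X(A) = ∫dλδ(Q′λ)e^{−½‖∂*A−Δλ‖²}`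
(`Z′ = X(0) ≠ 0`) and `Y_j(A) = ∫dλ′δ(Q′_jλ′)e^{−½‖∂*A−Δλ′‖²}` (`Z′_j = Y_j(0) ≠ 0`):
`exp[−½⟨QA,aQA⟩ − ½⟨A,(Δ−∂P∂*)A⟩ + ⟨A,J⟩] = exp[−½⟨QA,aQA⟩ − ½‖∂A‖² − ½‖(I−P_j)∂*A‖²] e^{⟨A,J⟩} · (Z′_j⁻¹Y_j(A)) · Z′ · X(A)⁻¹`
— the first line of (2.95) rewritten by *"the identity (1.27) valid for this operator P also"* (`…B6Eq295.eq295_gaugeFactor`: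
`e^{−½⟨A,(Δ−∂P∂*)A⟩}X(A) = e^{−½⟨A,ΔA⟩}Z′`), the quotient `NUM/DEN = 1` of the second line, and *"Let us apply (2.96) and
(1.27) to the denominator"* (`…B6Eq297GaugeFixing.eq127_j`: `Z′_j⁻¹Y_j(A) = e^{−½‖∂*A‖² + ½‖R_j∂*A‖²}`, which turns
`−½⟨A,ΔA⟩ = −½‖∂A‖² − ½‖∂*A‖²` into `−½‖∂A‖² − ½‖(I−P_j)∂*A‖²`, `I − P_j = R_j`).  `q` = the number `⟨QA,aQA⟩`.
[cite: Balaban1984PropagatorsII, (2.95)–(2.97) p.240] -/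
theorem integrand_295_eq_297 [MeasurableAdd NQ] [MeasurableAdd Nj] (μ' : Measure NQ) [μ'.IsAddLeftInvariant]
    (μj : Measure Nj) [μj.IsAddLeftInvariant] (lap : B →ₗ[ℝ] B) (κ : NQ →ₗ[ℝ] B) (ι : Nj →ₗ[ℝ] B)
    (K : Submodule ℝ B) [K.HasOrthogonalProjection] (hK : LinearMap.range (lap ∘ₗ κ) = K)
    (P : B →ₗ[ℝ] B) (hPK : ∀ g, P g = g - K.starProjection g)
    (Kj : Submodule ℝ B) [Kj.HasOrthogonalProjection] (hKj : LinearMap.range (lap ∘ₗ ι) = Kj)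
    (Rj : B →ₗ[ℝ] B) (hRj : ∀ g, Rj g = Kj.starProjection g)
    (lapV : A →ₗ[ℝ] A) (curl : A →ₗ[ℝ] T) (grad : B →ₗ[ℝ] A) (dv : A →ₗ[ℝ] B)
    (hgrad : ∀ (b : B) (x : A), ⟪grad b, x⟫_ℝ = ⟪b, dv x⟫_ℝ)
    (hlapV : ∀ v : A, ⟪v, lapV v⟫_ℝ = ‖curl v‖ ^ 2 + ‖dv v‖ ^ 2)
    (hZ' : ∫ m, Real.exp (-(1 / 2) * ‖lap (κ m)‖ ^ 2) ∂μ' ≠ 0)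
    (hZj : ∫ n, Real.exp (-(1 / 2) * ‖lap (ι n)‖ ^ 2) ∂μj ≠ 0) (q : ℝ) (J v : A) :
    Real.exp (-(1 / 2) * q - (1 / 2) * ⟪v, (lapV - grad ∘ₗ P ∘ₗ dv) v⟫_ℝ + ⟪v, J⟫_ℝ) =
      Real.exp (-(1 / 2) * q - (1 / 2) * ‖curl v‖ ^ 2 - (1 / 2) * ‖Rj (dv v)‖ ^ 2) * Real.exp ⟪v, J⟫_ℝ *
        ((∫ n, Real.exp (-(1 / 2) * ‖lap (ι n)‖ ^ 2) ∂μj)⁻¹ *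
          ∫ n, Real.exp (-(1 / 2) * ‖dv v - lap (ι n)‖ ^ 2) ∂μj) *
        (∫ m, Real.exp (-(1 / 2) * ‖lap (κ m)‖ ^ 2) ∂μ') *
        (∫ m, Real.exp (-(1 / 2) * ‖dv v - lap (κ m)‖ ^ 2) ∂μ')⁻¹ := by
  set X : ℝ := ∫ m, Real.exp (-(1 / 2) * ‖dv v - lap (κ m)‖ ^ 2) ∂μ' with hXdef
  set Zp : ℝ := ∫ m, Real.exp (-(1 / 2) * ‖lap (κ m)‖ ^ 2) ∂μ' with hZpdef
  -- (2.95)₂: e^{−½⟨A,(Δ−∂P∂*)A⟩}·X(A) = e^{−½⟨A,ΔA⟩}·Z′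
  have hadj' : ∀ (x : A) (g : B), ⟪x, grad g⟫_ℝ = ⟪dv x, g⟫_ℝ := fun x g => by
    rw [real_inner_comm, hgrad, real_inner_comm]
  have hgf := B6Eq295.eq295_gaugeFactor μ' (lap ∘ₗ κ) K hK lapV grad dv P hadj' hPK v
  simp only [LinearMap.coe_comp, Function.comp_apply] at hgf
  rw [← hXdef, ← hZpdef] at hgf
  have hX : X ≠ 0 := by
    intro h0
    rw [h0, mul_zero] at hgf
    exact mul_ne_zero (Real.exp_ne_zero _) hZ' hgf.symm
  have hM : Real.exp (-(1 / 2) * ⟪v, (lapV - grad ∘ₗ P ∘ₗ dv) v⟫_ℝ) =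
      Real.exp (-(1 / 2) * ⟪v, lapV v⟫_ℝ) * Zp * X⁻¹ := by
    rw [eq_mul_inv_iff_mul_eq₀ hX, hgf]
  -- (1.27) for P_j in the denominator
  have h127 := B6Eq297GaugeFixing.eq127_j μj lap ι Kj hKj Rj hRj hZj (dv v)
  have hR : ⟪dv v, Rj (dv v)⟫_ℝ = ‖Rj (dv v)‖ ^ 2 := by
    rw [hRj]; exact B6Eq297GaugeFixing.inner_starProjection_eq_norm_sq Kj (dv v)
  rw [h127, hR, show -(1 / 2) * q - (1 / 2) * ⟪v, (lapV - grad ∘ₗ P ∘ₗ dv) v⟫_ℝ + ⟪v, J⟫_ℝ =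
      (-(1 / 2) * q + ⟪v, J⟫_ℝ) + -(1 / 2) * ⟪v, (lapV - grad ∘ₗ P ∘ₗ dv) v⟫_ℝ by ring, Real.exp_add, hM, hlapV]
  have key : Real.exp (-(1 / 2) * q + ⟪v, J⟫_ℝ) * Real.exp (-(1 / 2) * (‖curl v‖ ^ 2 + ‖dv v‖ ^ 2)) =
      Real.exp (-(1 / 2) * q - (1 / 2) * ‖curl v‖ ^ 2 - (1 / 2) * ‖Rj (dv v)‖ ^ 2) * Real.exp ⟪v, J⟫_ℝ *
        Real.exp (-(1 / 2) * ‖dv v‖ ^ 2 + (1 / 2) * ‖Rj (dv v)‖ ^ 2) := by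
    rw [← Real.exp_add, ← Real.exp_add, ← Real.exp_add]
    ring_nf
  rw [← key]
  ring

omit [MeasurableSpace N1] in
/-- **(2.97) ⇒ (2.105): the gauge transformation `A → A − ∂λ₀`, `λ₀ = H′_jω`, pointwise.**  The (2.97) integrand
`exp[−½⟨QA,aQA⟩ − ½‖∂A‖² − ½‖(I−P_j)∂*A‖²]e^{⟨A,J⟩}·(Z′_j⁻¹∫dλ′δ(Q′_jλ′)e^{−½‖∂*A−Δλ′‖²})·Z′·X(A)⁻¹` evaluated at `A − ∂H′_jω` equals
the (2.105) integrand at `A`: the first exponential is unchanged ((2.103)–(2.104) `qterm_invariant` for the `Q`-terms,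
`∂∂ = 0` for `‖∂A‖²`, (2.98) `starProjection_lap_hP` for `‖(I−P_j)∂*A‖²`), *"only the term ⟨A,J⟩ is changed into
⟨A − ∂H′_jω, J⟩"* (factor `e^{−⟨∂H′_jω,J⟩}`), the `λ′`-integral becomes the fibre integral `δ(Q′_jλ′ − ω)` (`Y_translate`), and
the last integral `X` is unchanged (`X_translate`, `λ₀ ∈ N(Q′)` = `hκ`).  In the typing of `…B6Eq2112Assembly` this IS the
passage (2.97) ⇒ (2.105): there the `A`-integral of (2.97) at fixed `ω` runs over the configurations `A′ − ∂H′_jω`, `A′`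
gauge-fixed, so no translation of `dA` is even needed. [cite: Balaban1984PropagatorsII, (2.97) p.240, (2.103)–(2.105) pp.241–242] -/
theorem integrand_297_eq_2105 [MeasurableAdd NQ] (μ' : Measure NQ) [μ'.IsAddLeftInvariant] (μj : Measure Nj)
    (lap : B →ₗ[ℝ] B) (κ : NQ →ₗ[ℝ] B) (ι : Nj →ₗ[ℝ] B)
    (Kj : Submodule ℝ B) [Kj.HasOrthogonalProjection] (hKj : LinearMap.range (lap ∘ₗ ι) = Kj)
    (Rj : B →ₗ[ℝ] B) (hRj : ∀ g, Rj g = Kj.starProjection g)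
    (curl : A →ₗ[ℝ] T) (grad : B →ₗ[ℝ] A) (dv : A →ₗ[ℝ] B)
    (hΔ : ∀ b : B, dv (grad b) = lap b) (hcurl : ∀ b : B, curl (grad b) = 0)
    (hP : W →ₗ[ℝ] B) (ε : N1 →ₗ[ℝ] W) (Qp : B →ₗ[ℝ] W) (hQpH : Qp ∘ₗ hP = LinearMap.id)
    (Qv : A →ₗ[ℝ] Bs) (d1 : W →ₗ[ℝ] Bs) (Qpp : Bs →ₗ[ℝ] V) (a : V →ₗ[ℝ] V)
    (h2103 : ∀ b : B, Qv (grad b) = d1 (Qp b)) (h2104 : ∀ ω : N1, Qpp (d1 (ε ω)) = 0)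
    (horth : ∀ (n : Nj) (w : W), ⟪lap (ι n), lap (hP w)⟫_ℝ = 0)
    (hκ : ∀ ω : N1, ∃ m₀ : NQ, κ m₀ = hP (ε ω)) (Zp Zjinv : ℝ) (J v : A) (ω : N1) :
    Real.exp (-(1 / 2) * ⟪Qpp (Qv (v - grad (hP (ε ω)))), a (Qpp (Qv (v - grad (hP (ε ω)))))⟫_ℝ
          - (1 / 2) * ‖curl (v - grad (hP (ε ω)))‖ ^ 2 - (1 / 2) * ‖Rj (dv (v - grad (hP (ε ω))))‖ ^ 2) *
        Real.exp ⟪v - grad (hP (ε ω)), J⟫_ℝ *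
        (Zjinv * ∫ n, Real.exp (-(1 / 2) * ‖dv (v - grad (hP (ε ω))) - lap (ι n)‖ ^ 2) ∂μj) * Zp *
        (∫ m, Real.exp (-(1 / 2) * ‖dv (v - grad (hP (ε ω))) - lap (κ m)‖ ^ 2) ∂μ')⁻¹ =
      Real.exp (-(1 / 2) * ⟪Qpp (Qv v), a (Qpp (Qv v))⟫_ℝ - (1 / 2) * ‖curl v‖ ^ 2
          - (1 / 2) * ‖Rj (dv v)‖ ^ 2) * Real.exp ⟪v, J⟫_ℝ * Real.exp (-⟪grad (hP (ε ω)), J⟫_ℝ) *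
        (Zjinv * ∫ n, Real.exp (-(1 / 2) * ‖dv v - lap (ι n + hP (ε ω))‖ ^ 2) ∂μj) * Zp *
        (∫ m, Real.exp (-(1 / 2) * ‖dv v - lap (κ m)‖ ^ 2) ∂μ')⁻¹ := by
  -- the first exponential: (2.103)–(2.104), ∂∂ = 0, (2.98)
  have h1 : Qpp (Qv (v - grad (hP (ε ω)))) = Qpp (Qv v) :=
    qterm_invariant grad hP ε Qp hQpH Qv d1 Qpp h2103 h2104 v ω
  have h2 : curl (v - grad (hP (ε ω))) = curl v := by rw [map_sub, hcurl, sub_zero]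
  have h3 : Rj (dv (v - grad (hP (ε ω)))) = Rj (dv v) := by
    rw [map_sub, hΔ, map_sub, hRj (lap (hP (ε ω))), starProjection_lap_hP lap hP ι Kj hKj horth (ε ω), sub_zero]
  -- ⟨A − ∂H′_jω, J⟩
  have h4 : Real.exp ⟪v - grad (hP (ε ω)), J⟫_ℝ = Real.exp ⟪v, J⟫_ℝ * Real.exp (-⟪grad (hP (ε ω)), J⟫_ℝ) := by
    rw [← Real.exp_add, inner_sub_left, sub_eq_add_neg]
  rw [h1, h2, h3, h4, Y_translate μj lap ι grad dv hΔ hP ε v ω, X_translate μ' lap κ grad dv hΔ (hP (ε ω)) (hκ ω) v]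
  ring

omit [MeasurableSpace NQ] in
/-- **The `ω`-integral of the (2.105) integrand at fixed `A` — (2.106), (2.111) and the remark on `δ(Q′λ)` applied.**
With `Φ` = the invariant first exponential and `X = X(A)`: `∫dω↾_Λδ(Q′₁ω) Φe^{⟨A,J⟩}e^{−⟨∂H′_jω,J⟩}(Z′_j⁻¹∫dλ′δ(Q′_jλ′ − ω)
e^{−½‖∂*A−Δλ′‖²}) Z′X⁻¹ = (Z′Z′_j⁻¹cX⁻¹) · e^{½⟨J,K₁J⟩} · Φe^{⟨A,J⟩ − ⟨A,K₂J⟩}`, where *"∫dω′↾_Λδ(Q′₁ω′)δ(Q′_jλ′ − ω′) = δ(Q′λ′)"*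
is the displayed `hX` (`X = cX ·` the iterated integral), the quotient of the iterated integrals is the third member of
(2.106) (`…B6Eq2106.eq2105_quotient`, requiring `Z_λ(∂*A) ≠ 0`), and that quotient is (2.111) (`eq2111` + `eq2111_printed`:
`K₂ = ∂ΔH′_jCH′_j*∂*`, `K₁ = ∂H′_jCH′_j*∂*`). [cite: Balaban1984PropagatorsII, (2.105)–(2.106) p.242, (2.111)–(2.112) pp.242–243] -/
theorem integral_2105_omega [MeasurableAdd N1] (ν : Measure N1) [ν.IsAddLeftInvariant] (μj : Measure Nj)
    (lap : B →ₗ[ℝ] B) (ι : Nj →ₗ[ℝ] B) (hP : W →ₗ[ℝ] B) (hPs : B →ₗ[ℝ] W) (ε : N1 →ₗ[ℝ] W)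
    (grad : B →ₗ[ℝ] A) (dv : A →ₗ[ℝ] B) (hlap : ∀ x y : B, ⟪lap x, y⟫_ℝ = ⟪x, lap y⟫_ℝ)
    (hH : ∀ (w : W) (b : B), ⟪hP w, b⟫_ℝ = ⟪w, hPs b⟫_ℝ) (hgrad : ∀ (b : B) (x : A), ⟪grad b, x⟫_ℝ = ⟪b, dv x⟫_ℝ)
    (horth : ∀ (n : Nj) (w : W), ⟪lap (ι n), lap (hP w)⟫_ℝ = 0)
    (C : W →ₗ[ℝ] W) (TC : W →ₗ[ℝ] N1) (hC : ∀ x y : W, ⟪C x, y⟫_ℝ = ⟪x, C y⟫_ℝ) (hCr : ∀ s, C s = ε (TC s))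
    (hCsol : ∀ (ω : N1) (s : W), ⟪ε ω, (hPs ∘ₗ lap ∘ₗ lap ∘ₗ hP) (C s)⟫_ℝ = ⟪ε ω, s⟫_ℝ)
    (hZC : ∫ ω, Real.exp (-(1 / 2) * ⟪ε ω, (hPs ∘ₗ lap ∘ₗ lap ∘ₗ hP) (ε ω)⟫_ℝ) ∂ν ≠ 0)
    (J v : A) (hZl : ∫ n, Real.exp (-(1 / 2) * ‖lap (ι n)‖ ^ 2 + ⟪lap (ι n), dv v⟫_ℝ) ∂μj ≠ 0)
    (X cX : ℝ)
    (hX : X = cX * ∫ ω, ∫ n, Real.exp (-(1 / 2) * ‖dv v - lap (ι n + hP (ε ω))‖ ^ 2) ∂μj ∂ν) (Φ Zp Zjinv : ℝ) :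
    ∫ ω, Φ * Real.exp ⟪v, J⟫_ℝ * Real.exp (-⟪grad (hP (ε ω)), J⟫_ℝ) *
        (Zjinv * ∫ n, Real.exp (-(1 / 2) * ‖dv v - lap (ι n + hP (ε ω))‖ ^ 2) ∂μj) * Zp * X⁻¹ ∂ν =
      (Zp * Zjinv * cX⁻¹) * Real.exp ((1 / 2) * ⟪J, (grad ∘ₗ hP ∘ₗ C ∘ₗ hPs ∘ₗ dv) J⟫_ℝ) *
        (Φ * Real.exp (⟪v, J⟫_ℝ - ⟪v, (grad ∘ₗ lap ∘ₗ hP ∘ₗ C ∘ₗ hPs ∘ₗ dv) J⟫_ℝ)) := by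
  set NUM : ℝ := ∫ ω, Real.exp (-⟪grad (hP (ε ω)), J⟫_ℝ) *
    (∫ n, Real.exp (-(1 / 2) * ‖dv v - lap (ι n + hP (ε ω))‖ ^ 2) ∂μj) ∂ν with hNUM
  set DEN : ℝ := ∫ ω, ∫ n, Real.exp (-(1 / 2) * ‖dv v - lap (ι n + hP (ε ω))‖ ^ 2) ∂μj ∂ν with hDEN
  -- pull the ω-independent factors out of the ω-integral
  have hpull : ∫ ω, Φ * Real.exp ⟪v, J⟫_ℝ * Real.exp (-⟪grad (hP (ε ω)), J⟫_ℝ) *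
        (Zjinv * ∫ n, Real.exp (-(1 / 2) * ‖dv v - lap (ι n + hP (ε ω))‖ ^ 2) ∂μj) * Zp * X⁻¹ ∂ν =
      (Φ * Real.exp ⟪v, J⟫_ℝ * Zjinv * Zp * X⁻¹) * NUM := by
    rw [hNUM, ← integral_const_mul]
    congr 1
    funext ω
    ring
  -- Δ′_j = H′_j*Δ²H′_j is symmetric
  have hHs : ∀ (b : B) (w : W), ⟪hPs b, w⟫_ℝ = ⟪b, hP w⟫_ℝ := fun b w => by
    rw [real_inner_comm, ← hH, real_inner_comm]
  have hDp : ∀ x y : W, ⟪(hPs ∘ₗ lap ∘ₗ lap ∘ₗ hP) x, y⟫_ℝ = ⟪x, (hPs ∘ₗ lap ∘ₗ lap ∘ₗ hP) y⟫_ℝ := by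
    intro x y
    simp only [LinearMap.coe_comp, Function.comp_apply]
    rw [hHs, hlap, hlap, hH]
  -- (2.105) ⇒ (2.106): the quotient of the iterated integrals is the third member of (2.106)
  have hq := B6Eq2106.eq2105_quotient μj ν lap hP hPs grad dv ι ε horth hlap hH hgrad (dv v) J hZl
  -- (2.111)
  have h3 := eq2111 ν ε (hPs ∘ₗ lap ∘ₗ lap ∘ₗ hP) C TC hDp hC hCr hCsol hZC (hPs (lap (dv v))) (hPs (dv J))
  have h4 := eq2111_printed lap hP hPs grad dv C hlap hH hgrad v J
  rw [hpull, hX, mul_inv]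
  calc Φ * Real.exp ⟪v, J⟫_ℝ * Zjinv * Zp * (cX⁻¹ * DEN⁻¹) * NUM
      = Φ * Real.exp ⟪v, J⟫_ℝ * Zjinv * Zp * cX⁻¹ * (NUM * DEN⁻¹) := by ring
    _ = Φ * Real.exp ⟪v, J⟫_ℝ * Zjinv * Zp * cX⁻¹ *
          Real.exp (-⟪v, (grad ∘ₗ lap ∘ₗ hP ∘ₗ C ∘ₗ hPs ∘ₗ dv) J⟫_ℝ +
            (1 / 2) * ⟪J, (grad ∘ₗ hP ∘ₗ C ∘ₗ hPs ∘ₗ dv) J⟫_ℝ) := by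
        rw [hNUM, hDEN, hq, h3, h4]
    _ = _ := by
        rw [Real.exp_add, Real.exp_sub, Real.exp_neg]
        ring

omit [MeasurableSpace Nj] [MeasurableSpace NQ] [MeasurableSpace N1] in
/-- **The integrand of (2.112).**  The invariant first exponential of (2.97)/(2.105) times `e^{⟨A,J⟩ − ⟨A,K₂J⟩}` is
`exp[−½⟨QA,aQA⟩ − ½⟨A,(Δ−∂P_j∂*)A⟩ + ⟨A, J − K₂J⟩]`, the `A`-integrand of (2.112) (`⟨A,ΔA⟩ = ‖∂A‖² + ‖∂*A‖²`,
`P_j = I − R_j`, so `⟨A,(Δ−∂P_j∂*)A⟩ = ‖∂A‖² + ‖(I−P_j)∂*A‖²`; `k` = `K₂J`). [cite: Balaban1984PropagatorsII, (2.112) p.243] -/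
theorem integrand_2112 (Kj : Submodule ℝ B) [Kj.HasOrthogonalProjection] (Rj Pj : B →ₗ[ℝ] B)
    (hRj : ∀ g, Rj g = Kj.starProjection g) (hPj : ∀ g, Pj g = g - Kj.starProjection g)
    (lapV : A →ₗ[ℝ] A) (curl : A →ₗ[ℝ] T) (grad : B →ₗ[ℝ] A) (dv : A →ₗ[ℝ] B)
    (hgrad : ∀ (b : B) (x : A), ⟪grad b, x⟫_ℝ = ⟪b, dv x⟫_ℝ)
    (hlapV : ∀ v : A, ⟪v, lapV v⟫_ℝ = ‖curl v‖ ^ 2 + ‖dv v‖ ^ 2) (q : ℝ) (J k v : A) :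
    Real.exp (-(1 / 2) * q - (1 / 2) * ‖curl v‖ ^ 2 - (1 / 2) * ‖Rj (dv v)‖ ^ 2) *
        Real.exp (⟪v, J⟫_ℝ - ⟪v, k⟫_ℝ) =
      Real.exp (-(1 / 2) * q - (1 / 2) * ⟪v, (lapV - grad ∘ₗ Pj ∘ₗ dv) v⟫_ℝ + ⟪v, J - k⟫_ℝ) := by
  have hadj' : ⟪v, grad (Pj (dv v))⟫_ℝ = ⟪dv v, Pj (dv v)⟫_ℝ := by
    rw [real_inner_comm, hgrad, real_inner_comm]
  have hquad : ⟪v, (lapV - grad ∘ₗ Pj ∘ₗ dv) v⟫_ℝ = ‖curl v‖ ^ 2 + ‖Rj (dv v)‖ ^ 2 := by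
    rw [LinearMap.sub_apply, inner_sub_right, hlapV, LinearMap.comp_apply, LinearMap.comp_apply, hadj', hPj,
      inner_sub_right, real_inner_self_eq_norm_sq, hRj, B6Eq297GaugeFixing.inner_starProjection_eq_norm_sq Kj (dv v)]
    ring
  rw [← Real.exp_add, hquad, inner_sub_right]
  ring_nf

omit [MeasurableSpace NQ] [MeasurableSpace N1] in
/-- `Z_λ(∂*A) = ∫dλ′δ(Q′_jλ′)e^{−½‖Δλ′‖² + ⟨Δλ′,∂*A⟩} ≠ 0` whenever `Z′_j ≠ 0` (it is `e^{½⟨∂*A,R_j∂*A⟩}Z′_j` by (2.25),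
`…B6Eq295.eq225`) — the non-vanishing required by `…B6Eq2106.eq2105_quotient`. [cite: Balaban1984PropagatorsII, (2.106) p.242] -/
theorem Zlam_ne_zero [MeasurableAdd Nj] (μj : Measure Nj) [μj.IsAddLeftInvariant] (lap : B →ₗ[ℝ] B) (ι : Nj →ₗ[ℝ] B)
    (Kj : Submodule ℝ B) [Kj.HasOrthogonalProjection] (hKj : LinearMap.range (lap ∘ₗ ι) = Kj)
    (Rj : B →ₗ[ℝ] B) (hRj : ∀ g, Rj g = Kj.starProjection g)
    (hZj : ∫ n, Real.exp (-(1 / 2) * ‖lap (ι n)‖ ^ 2) ∂μj ≠ 0) (g : B) :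
    ∫ n, Real.exp (-(1 / 2) * ‖lap (ι n)‖ ^ 2 + ⟪lap (ι n), g⟫_ℝ) ∂μj ≠ 0 := by
  have h := B6Eq295.eq225 μj (lap ∘ₗ ι) Kj hKj Rj hRj g
  simp only [LinearMap.coe_comp, Function.comp_apply] at h
  simp_rw [real_inner_comm g]
  rw [h]
  exact mul_ne_zero (Real.exp_ne_zero _) hZj

end Pointwise

end Literature.MathematicalPhysics.QuantumFieldTheory.Balaban1983to89.B6Eq2112

end
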